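import Literature.NumberTheory.Automorphic.UnitaryCartanRegularAE                     -- ★ p851336 «CARTAN-NULL DISCHARGE» on the matrix carrier `U(J)(F_v)` (B3)
import Summits.HodgeConjecture.HodgeConjecture.Theorems.F0P3cStCharTSCartanFields    -- ★ p851300 S9a (LH6-p01 (g4)): `ellCartanAE_of_compact_centralizers … (hnull)`
import Literature.NumberTheory.Rogawski1990.CMLocalAPacketMembers                      -- ★ `Gqs L v = U(Φ₃)(L⁺_v)`
import HarnessLib

/-!
# F0 · P3c · line LH6 «StCharTS» — «CARTAN-NULL★» DISCHARGED (datum road S9b′, sequel): Haar-almost every element of EVERY Cartan subgroup `Z(γ₀)` of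
# `U(Φ₃)(L⁺_v)` is regular (non-split `v`), hence the `hnull` input of ★ S9a and the socket (C2) `EllCartanAE` of (S-𝔇) need no per-torus hypothesis
# [HarishChandra1970, Lemma 42; Rogawski1990, §3.6, §12.5 p. 184]

Cell `pub/hodgecm-mathlib`, crux H413 = `stmt-HodgeConjecture-24833` (lane `--supports …`), route HCCMUnconditional; seat F0P3-p04 (g17), datum road of LH6-p01 (g4)
(slice S9b′).  THEOREMS ONLY (no definition ∕ instance ∕ notation ∕ named fact ∕ `sorry`); ★-only imports.

WHAT.  ★ `F0P3cStCharTSCartanNull` (p851303) delivered the binder `hnull : ∀ T ∈ 𝔇.cartanG, ∀ᵐ t ∂(𝔇.μT T), IsRegularElt t` of ★ S9a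
`F0P3cStCharTSCartanFields.ellCartanAE_of_compact_centralizers` from ROOT-KERNEL hypotheses; the Literature sequel (★ `CommutantEigencharacters` p851310 — the
eigencharacters `χ_i` of the commutant of a regular semisimple matrix; ★ `UnitaryCentralizerSingularLocus` p851322 — the singular locus of `Z_{U(σ,J)}(γ₀)` lies in
the closed non-open root kernels `{χ_i = χ_j}`, Cayley-transform witnesses `c(ε_k X) → 1`; ★ `UnitaryCartanRegularAE` p851336 — the non-split CM∕quadratic dress
through the one-place model ★ `localNonsplitEquiv` and Steinhaus) DISCHARGES those hypotheses for every Cartan subgroup `T = Z(γ₀)`, `γ₀` regular, of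
`Gqs L v = U(Φ₃)(L⁺_v)` at a non-split place.  Here, the `Gqs`-typed heads the junction consumes:
* `ae_isRegularElt_centralizer_Gqs (w) (hw) (γ₀) (hγ₀) (μT) [μT.IsHaarMeasure]` — `μT`-a.e. `t ∈ Z(γ₀)` is regular, ANY Haar `μT` (no compactness needed);
* **`cartanNull_of_centralizers (hns) (𝔇) (hcart′) (hHaarG)`** — the junction's FIELD hypothesis `hnull` DERIVED from `hcart′ : ∀ T ∈ 𝔇.cartanG, ∃ γ₀ regular,
  T = Z(γ₀)` (the constructor's elliptic representatives) and `hHaarG : ∀ T ∈ 𝔇.cartanG, (𝔇.μT T).IsHaarMeasure` (PLAN S9 D4: `μT T` is THE Haar measure of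
  mass one), at a non-split `v` (`hns`, the organ's first binder);
* **`ellCartanAE_of_compact_centralizers_nonsplit (hns) (𝔇) (hE) (hcart) (hHaarG) : 𝔇.EllCartanAE`** — ★ S9a's (C2) with `hnull` discharged: (C2) now costs only
  FIELD hypotheses (`hE`, `hcart`, `hHaarG`).
HONEST LABEL.  HC_CM is proved only modulo the 7 printed citations (2 remaining named inputs: hLiu418 = `stmt-HodgeConjecture-24832`, h413 = `stmt-HodgeConjecture-24833`)
until rung 0 closes; this file closes no organ — it removes the named input «CARTAN-NULL» (N2) from the datum road (count-neutral).

## References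
* [HarishChandra1970] Harish-Chandra (notes by G. van Dijk), *Harmonic Analysis on Reductive p-adic Groups*, LNM 162 (1970), Lemma 42.
* [Rogawski1990] J. D. Rogawski, *Automorphic Representations of Unitary Groups in Three Variables*, Ann. of Math. Stud. 123 (1990): §3.6 pp. 28–31; §12.5 pp. 182–184.
* [Folland1995] G. B. Folland, *A Course in Abstract Harmonic Analysis* (1995), Prop. 2.4 (Steinhaus).
-/

set_option autoImplicit false
-- the mandated namespace has the single-problem summit's repeated segment (`HodgeConjecture.HodgeConjecture`)
set_option linter.dupNamespace false

noncomputable section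

open NumberField IsDedekindDomain MeasureTheory Filter Topology
open scoped Matrix MatrixGroups
open Literature.NumberTheory.Rogawski1990 Literature.NumberTheory.Automorphic Literature.NumberTheory.Automorphic.UnitaryGroup
open Literature.NumberTheory.Rogawski1990.Ch12Sec5
open Summit.HodgeConjecture.HodgeConjecture.Cruxes.H413.F0P3cStCharTSTorusDefs

namespace Summit.HodgeConjecture.HodgeConjecture.Cruxes.H413.F0P3cStCharTSCartanNullDischarge

section U3

variable (L : Type) [Field L] [NumberField L] [IsCMField L] (v : HeightOneSpectrum (𝓞 ↥(maximalRealSubfield L)))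

omit [NumberField L] [IsCMField L] in
/-- `Φ₃ = antidiag(1,1,1)` is invertible (★ `isUnit_antidiagOne_det`). [cite: Rogawski1990, §12.2 p. 173] -/
theorem isUnit_qsForm : IsUnit (qsForm L) :=
  (Matrix.isUnit_iff_isUnit_det _).2 (isUnit_antidiagOne_det L 3)

/-- **Haar-almost every element of a Cartan subgroup `Z(γ₀) ≤ U(Φ₃)(L⁺_v)` is regular** (`γ₀` regular, `v` non-split with `w ∣ v` fixed by `c`, `μT` ANY Haar
measure on `Z(γ₀)`; no compactness needed): ★ `ae_isRegularElt_centralizer_local` read on the `Gqs` carrier (definitionally the matrix carrier `U(Φ₃)(L⁺_v)`).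
[cite: HarishChandra1970, Lemma 42] [cite: Rogawski1990, §12.5 p. 184; §3.6 pp. 28–31] -/
theorem ae_isRegularElt_centralizer_Gqs (w : PlacesOver L v) (hw : IsCMField.complexConj L • w.1 = w.1)
    (γ₀ : Gqs L v) (hγ₀ : IsRegularElt (γ₀.val : GL (Fin 3) (UnitaryGroup.LocalRing L v)))
    [instM : MeasurableSpace (Gqs L v)] [instB : BorelSpace (Gqs L v)]
    (μT : Measure ↥(Subgroup.centralizer ({γ₀} : Set (Gqs L v)))) [hμT : μT.IsHaarMeasure] :
    ∀ᵐ t : ↥(Subgroup.centralizer ({γ₀} : Set (Gqs L v))) ∂μT, IsRegularElt ((t : Gqs L v).val : GL (Fin 3) (UnitaryGroup.LocalRing L v)) := by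
  exact @ae_isRegularElt_centralizer_local _ _ _ _ _ _ _ _ (IsCMField.complexConj L) 3 (qsForm L) _ (IsCMField.complexConj_ne_one L) w hw
    (isUnit_qsForm L) γ₀ hγ₀ instM instB μT hμT

/-- **«CARTAN-NULL★» DISCHARGED — the `hnull` binder of ★ S9a `ellCartanAE_of_compact_centralizers` ∕ the junction's field hypothesis `hnull`, DERIVED**: at a
non-split `v` (the organ's `hns`), for any §12.5 datum `𝔇` on `(U(Φ₃)(L⁺_v), H)` whose elliptic Cartan representatives are centralisers of regular elements and carry
Haar measures `𝔇.μT T` (PLAN S9 D4), Haar-almost every `t ∈ T` is regular, for every `T ∈ 𝔇.cartanG`. [cite: HarishChandra1970, Lemma 42]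
[cite: Rogawski1990, §12.5 p. 184; §3.6 pp. 28–31] -/
theorem cartanNull_of_centralizers (hns : ∀ w : PlacesOver L v, IsCMField.complexConj L • w.1 = w.1)
    [MeasurableSpace (Gqs L v)] [BorelSpace (Gqs L v)]
    [∀ γ : Gqs L v, MeasurableSpace (Gqs L v ⧸ Subgroup.centralizer ({γ} : Set (Gqs L v)))]
    [MeasurableSpace (Gqs L v ⧸ Subgroup.center (Gqs L v))]
    {H' : Type} [Group H'] [TopologicalSpace H'] [IsTopologicalGroup H'] [MeasurableSpace H']
    (𝔇 : EllipticData (Gqs L v) H')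
    (hcart' : ∀ T ∈ 𝔇.cartanG,
      ∃ γ₀ : Gqs L v, IsRegularElt (γ₀.val : GL (Fin 3) (UnitaryGroup.LocalRing L v)) ∧ T = Subgroup.centralizer ({γ₀} : Set (Gqs L v)))
    (hHaarG : ∀ T ∈ 𝔇.cartanG, (𝔇.μT T).IsHaarMeasure) :
    ∀ T ∈ 𝔇.cartanG, ∀ᵐ t : ↥T ∂(𝔇.μT T), IsRegularElt ((t : Gqs L v).val : GL (Fin 3) (UnitaryGroup.LocalRing L v)) := by
  obtain ⟨w⟩ : Nonempty (PlacesOver L v) := inferInstance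
  intro T hT
  haveI := hHaarG T hT
  obtain ⟨γ₀, hγ₀, rfl⟩ := hcart' T hT
  exact ae_isRegularElt_centralizer_Gqs L v w (hns w) γ₀ hγ₀ (𝔇.μT _)

/-- The same with ★ S9a's `hcart` (compactness ∧ centraliser) as the structural input — the junction's literal `hcart`. [cite: HarishChandra1970, Lemma 42]
[cite: Rogawski1990, §12.5 p. 184] -/
theorem cartanNull_of_compact_centralizers (hns : ∀ w : PlacesOver L v, IsCMField.complexConj L • w.1 = w.1)
    [MeasurableSpace (Gqs L v)] [BorelSpace (Gqs L v)]
    [∀ γ : Gqs L v, MeasurableSpace (Gqs L v ⧸ Subgroup.centralizer ({γ} : Set (Gqs L v)))]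
    [MeasurableSpace (Gqs L v ⧸ Subgroup.center (Gqs L v))]
    {H' : Type} [Group H'] [TopologicalSpace H'] [IsTopologicalGroup H'] [MeasurableSpace H']
    (𝔇 : EllipticData (Gqs L v) H')
    (hcart : ∀ T ∈ 𝔇.cartanG, IsCompact (T : Set (Gqs L v)) ∧
      ∃ γ₀ : Gqs L v, IsRegularElt (γ₀.val : GL (Fin 3) (UnitaryGroup.LocalRing L v)) ∧ T = Subgroup.centralizer ({γ₀} : Set (Gqs L v)))
    (hHaarG : ∀ T ∈ 𝔇.cartanG, (𝔇.μT T).IsHaarMeasure) :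
    ∀ T ∈ 𝔇.cartanG, ∀ᵐ t : ↥T ∂(𝔇.μT T), IsRegularElt ((t : Gqs L v).val : GL (Fin 3) (UnitaryGroup.LocalRing L v)) :=
  cartanNull_of_centralizers L v hns 𝔇 (fun T hT => (hcart T hT).2) hHaarG

/-- **(C2) `EllCartanAE` AT COMPACT-CENTRALISER REPRESENTATIVES, «CARTAN-NULL» DISCHARGED**: ★ S9a's `ellCartanAE_of_compact_centralizers` with its last input
`hnull` supplied by `cartanNull_of_compact_centralizers` — (C2) now holds at any §12.5 datum on `(U(Φ₃)(L⁺_v), H)` (non-split `v`) whose `ellG` is `G^r ∖ Ω`, whose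
elliptic representatives are compact centralisers of regular elements, and whose `μT T` (`T ∈ cartanG`) are Haar measures: FIELD hypotheses only.
[cite: Rogawski1990, §12.5 p. 184; §3.6 pp. 28–31] [cite: HarishChandra1970, Lemma 42] -/
theorem ellCartanAE_of_compact_centralizers_nonsplit (hns : ∀ w : PlacesOver L v, IsCMField.complexConj L • w.1 = w.1)
    [MeasurableSpace (Gqs L v)] [BorelSpace (Gqs L v)]
    [∀ γ : Gqs L v, MeasurableSpace (Gqs L v ⧸ Subgroup.centralizer ({γ} : Set (Gqs L v)))]
    [MeasurableSpace (Gqs L v ⧸ Subgroup.center (Gqs L v))]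
    {H' : Type} [Group H'] [TopologicalSpace H'] [IsTopologicalGroup H'] [MeasurableSpace H']
    (𝔇 : EllipticData (Gqs L v) H')
    (hE : ∀ γ : Gqs L v, γ ∈ 𝔇.ellG ↔ IsRegularElt (γ.val : GL (Fin 3) (UnitaryGroup.LocalRing L v)) ∧ γ ∉ hyperbolicSet L v)
    (hcart : ∀ T ∈ 𝔇.cartanG, IsCompact (T : Set (Gqs L v)) ∧
      ∃ γ₀ : Gqs L v, IsRegularElt (γ₀.val : GL (Fin 3) (UnitaryGroup.LocalRing L v)) ∧ T = Subgroup.centralizer ({γ₀} : Set (Gqs L v)))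
    (hHaarG : ∀ T ∈ 𝔇.cartanG, (𝔇.μT T).IsHaarMeasure) :
    𝔇.EllCartanAE :=
  F0P3cStCharTSCartanFields.ellCartanAE_of_compact_centralizers L v 𝔇 hE hcart (cartanNull_of_compact_centralizers L v hns 𝔇 hcart hHaarG)

/-! ## ED. 2 — the ROOT-KERNEL form `hker` of ★ `F0P3cStCharTSCartanNull` ∕ junction hypothesis `hker`, discharged (same road, same seat) -/

/-- **The root-kernel cover of a Cartan subgroup `Z(γ₀) ≤ U(Φ₃)(L⁺_v)`, on the `Gqs` carrier**: the singular locus `{t ∈ Z(γ₀) | ¬ IsRegularElt t}` lies in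
finitely many CLOSED, NON-OPEN subgroups of `Z(γ₀)` (`γ₀` regular, `v` non-split) — ★ `exists_finset_subgroup_cover_singular_centralizer_local` read on `Gqs L v`.
[cite: HarishChandra1970, Lemma 42] [cite: Rogawski1990, §3.6 pp. 28–31] -/
theorem rootKernels_centralizer_Gqs (w : PlacesOver L v) (hw : IsCMField.complexConj L • w.1 = w.1)
    (γ₀ : Gqs L v) (hγ₀ : IsRegularElt (γ₀.val : GL (Fin 3) (UnitaryGroup.LocalRing L v))) :
    ∃ s : Finset (Subgroup ↥(Subgroup.centralizer ({γ₀} : Set (Gqs L v)))),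
      (∀ K ∈ s, IsClosed (K : Set ↥(Subgroup.centralizer ({γ₀} : Set (Gqs L v)))) ∧
        ¬ IsOpen (K : Set ↥(Subgroup.centralizer ({γ₀} : Set (Gqs L v))))) ∧
      ∀ t : ↥(Subgroup.centralizer ({γ₀} : Set (Gqs L v))),
        ¬ IsRegularElt ((t : Gqs L v).val : GL (Fin 3) (UnitaryGroup.LocalRing L v)) → ∃ K ∈ s, t ∈ K :=
  exists_finset_subgroup_cover_singular_centralizer_local (IsCMField.complexConj L) 3 (qsForm L) (IsCMField.complexConj_ne_one L) w hw
    (isUnit_qsForm L) (γ₀ : UnitaryGroup.«local» L (IsCMField.complexConj L) 3 (qsForm L) v) hγ₀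

/-- **The junction's FIELD hypothesis `hker` (= the `hker` binder of ★ `F0P3cStCharTSCartanNull.cartanNull_of_rootKernels`), DERIVED** at a non-split `v` from
`hcart′ : ∀ T ∈ 𝔇.cartanG, ∃ γ₀ regular, T = Z(γ₀)`: every elliptic Cartan representative has its singular locus inside finitely many closed non-open subgroups.
No measure enters. [cite: HarishChandra1970, Lemma 42] [cite: Rogawski1990, §3.6 pp. 28–31; §12.5 p. 184] -/
theorem rootKernels_of_centralizers (hns : ∀ w : PlacesOver L v, IsCMField.complexConj L • w.1 = w.1)
    [MeasurableSpace (Gqs L v)]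
    [∀ γ : Gqs L v, MeasurableSpace (Gqs L v ⧸ Subgroup.centralizer ({γ} : Set (Gqs L v)))]
    [MeasurableSpace (Gqs L v ⧸ Subgroup.center (Gqs L v))]
    {H' : Type} [Group H'] [TopologicalSpace H'] [IsTopologicalGroup H'] [MeasurableSpace H']
    (𝔇 : EllipticData (Gqs L v) H')
    (hcart' : ∀ T ∈ 𝔇.cartanG,
      ∃ γ₀ : Gqs L v, IsRegularElt (γ₀.val : GL (Fin 3) (UnitaryGroup.LocalRing L v)) ∧ T = Subgroup.centralizer ({γ₀} : Set (Gqs L v))) :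
    ∀ T ∈ 𝔇.cartanG, ∃ s : Finset (Subgroup ↥T), (∀ K ∈ s, IsClosed (K : Set ↥T) ∧ ¬ IsOpen (K : Set ↥T)) ∧
      ∀ t : ↥T, ¬ IsRegularElt ((t : Gqs L v).val : GL (Fin 3) (UnitaryGroup.LocalRing L v)) → ∃ K ∈ s, t ∈ K := by
  obtain ⟨w⟩ : Nonempty (PlacesOver L v) := inferInstance
  intro T hT
  obtain ⟨γ₀, hγ₀, rfl⟩ := hcart' T hT
  exact rootKernels_centralizer_Gqs L v w (hns w) γ₀ hγ₀

/-- The same from ★ S9a's ∕ the junction's literal `hcart` (compactness ∧ centraliser) — the TOKEN-FOR-TOKEN replacement of the junction's `hker` (★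
`F0P3cStCharTSDatumJunction`, hypothesis h15): `hker := rootKernels_of_compact_centralizers L v hns 𝔇 hcart`. [cite: HarishChandra1970, Lemma 42]
[cite: Rogawski1990, §12.5 p. 184] -/
theorem rootKernels_of_compact_centralizers (hns : ∀ w : PlacesOver L v, IsCMField.complexConj L • w.1 = w.1)
    [MeasurableSpace (Gqs L v)]
    [∀ γ : Gqs L v, MeasurableSpace (Gqs L v ⧸ Subgroup.centralizer ({γ} : Set (Gqs L v)))]
    [MeasurableSpace (Gqs L v ⧸ Subgroup.center (Gqs L v))]
    {H' : Type} [Group H'] [TopologicalSpace H'] [IsTopologicalGroup H'] [MeasurableSpace H']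
    (𝔇 : EllipticData (Gqs L v) H')
    (hcart : ∀ T ∈ 𝔇.cartanG, IsCompact (T : Set (Gqs L v)) ∧
      ∃ γ₀ : Gqs L v, IsRegularElt (γ₀.val : GL (Fin 3) (UnitaryGroup.LocalRing L v)) ∧ T = Subgroup.centralizer ({γ₀} : Set (Gqs L v))) :
    ∀ T ∈ 𝔇.cartanG, ∃ s : Finset (Subgroup ↥T), (∀ K ∈ s, IsClosed (K : Set ↥T) ∧ ¬ IsOpen (K : Set ↥T)) ∧
      ∀ t : ↥T, ¬ IsRegularElt ((t : Gqs L v).val : GL (Fin 3) (UnitaryGroup.LocalRing L v)) → ∃ K ∈ s, t ∈ K :=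
  rootKernels_of_centralizers L v hns 𝔇 fun T hT => (hcart T hT).2

/-! ## ED. 3 — the junction's `hfinG` (finite torus measures on the elliptic representatives) from `hcart` + `hHaarG` -/

/-- **A Haar measure on a COMPACT Cartan representative is finite**: the junction's FIELD hypothesis `hfinG : ∀ T ∈ 𝔇.cartanG, IsFiniteMeasure (𝔇.μT T)`
(★ `F0P3cStCharTSDatumJunction`, consumed by ★ S9c `l2dEll_of_hcBounded`) DERIVED from `hcart` (compactness) and `hHaarG` (Haar): `hfinG := isFiniteMeasure_of_compact_haar L v 𝔇
hcart hHaarG`.  (Any datum, any place; no regularity used.) [cite: Rogawski1990, §12.5 p. 184] -/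
theorem isFiniteMeasure_of_compact_haar
    [MeasurableSpace (Gqs L v)]
    [∀ γ : Gqs L v, MeasurableSpace (Gqs L v ⧸ Subgroup.centralizer ({γ} : Set (Gqs L v)))]
    [MeasurableSpace (Gqs L v ⧸ Subgroup.center (Gqs L v))]
    {H' : Type} [Group H'] [TopologicalSpace H'] [IsTopologicalGroup H'] [MeasurableSpace H']
    (𝔇 : EllipticData (Gqs L v) H')
    (hcart : ∀ T ∈ 𝔇.cartanG, IsCompact (T : Set (Gqs L v)) ∧
      ∃ γ₀ : Gqs L v, IsRegularElt (γ₀.val : GL (Fin 3) (UnitaryGroup.LocalRing L v)) ∧ T = Subgroup.centralizer ({γ₀} : Set (Gqs L v)))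
    (hHaarG : ∀ T ∈ 𝔇.cartanG, (𝔇.μT T).IsHaarMeasure) :
    ∀ T ∈ 𝔇.cartanG, IsFiniteMeasure (𝔇.μT T) := by
  intro T hT
  haveI := hHaarG T hT
  haveI : CompactSpace ↥T := isCompact_iff_compactSpace.1 (hcart T hT).1
  infer_instance

/-- The same from compactness alone (`hK : ∀ T ∈ 𝔇.cartanG, IsCompact ↑T`, the shape ★ S9c consumes) and `hHaarG`. [cite: Rogawski1990, §12.5 p. 184] -/
theorem isFiniteMeasure_of_isCompact_haar
    [MeasurableSpace (Gqs L v)]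
    [∀ γ : Gqs L v, MeasurableSpace (Gqs L v ⧸ Subgroup.centralizer ({γ} : Set (Gqs L v)))]
    [MeasurableSpace (Gqs L v ⧸ Subgroup.center (Gqs L v))]
    {H' : Type} [Group H'] [TopologicalSpace H'] [IsTopologicalGroup H'] [MeasurableSpace H']
    (𝔇 : EllipticData (Gqs L v) H')
    (hK : ∀ T ∈ 𝔇.cartanG, IsCompact (T : Set (Gqs L v)))
    (hHaarG : ∀ T ∈ 𝔇.cartanG, (𝔇.μT T).IsHaarMeasure) :
    ∀ T ∈ 𝔇.cartanG, IsFiniteMeasure (𝔇.μT T) := by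
  intro T hT
  haveI := hHaarG T hT
  haveI : CompactSpace ↥T := isCompact_iff_compactSpace.1 (hK T hT)
  infer_instance

end U3

end Summit.HodgeConjecture.HodgeConjecture.Cruxes.H413.F0P3cStCharTSCartanNullDischarge

end
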